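import Summits.RiemannHypothesis.RiemannHypothesis.Theorems.TiltedLandingLaw421E3Literal
import Summits.RiemannHypothesis.RiemannHypothesis.Theorems.TiltedLandingLaw421StubAnalyticHeredity
import Summits.RiemannHypothesis.RiemannHypothesis.Theses.EarlyAppointments

/-! # TiltedLandingLaw421R2StSwap
W-08 round-2 St-SWAP KIT side (ns `RhW08.StSwap`, Round1-free): C4 kit a4c78317 subset (§A interface, §E/§F tracked-seed vocabulary, §G SubPred inheritance) + C4 g24 §K.1 `ChainOf`.
SUPPORT module for crux `TiltedLandingLaw421` (stmt-RiemannHypothesis-24774), `--supports` only: proves no stub, no crux; fully proved (no `sorry`).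
ROUND-2 DRY CUT by tenure rh-tenure-earlyapp-1 g5 (NOT keyed, NOT of record) from the single rc-0 base `R1K8R2KCheck-W08-C1-rh-idea-5-g23.lean` fef2bb59
(C1 RIDER-42 BASE-A): decl blocks byte-verbatim, base order, dependency closure of the round-2 nodes; K = kernel-checked lemmas about MODEL sockets (combs), not ζ/Ξ. RH is not proved. -/

-- ----- from C4 g23 kit a4c78317 §A–§H -----
-- ===== BEGIN C4 kit StSwapKit-W08-C4-rh-idea-6-g23.lean a4c78317 (body verbatim below its import line) =====

namespace RhW08.StSwap

open Complex Set
open scoped ComplexConjugate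
open RhIdea6.G17.W07C7 RhIdea6.G17.W07C7.Rev6 RhIdea6.G18.W07C8.Law421BirthS RhIdea6.G19.W07C11.Seam
open RhIdea6.G20.W07C12.Frac RhIdea6.G20.W07C12.StColP RhW07.C12.FieldSplit RhIdea6.G20.W07C13pre.Tent RhIdea6.G21.W07C13.TentMax
open RhW07.C14.TwoSided RhW07.C14.Classes RhW07.C14.Lineage

/-- (S-fin) the level sets of `St` are finite on engine data. -/
def LevelFinite (St : StatePred) : Prop :=
  ∀ (η : ℝ) (f : ℂ → ℂ) (x₀ s hmax R Hs : ℝ) (B : ℕ), EngineHyps5 2 η f x₀ s hmax R Hs B →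
    ∀ j : ℕ, {u : ℂ | St η f x₀ s hmax R Hs B j u}.Finite

/-- (S-up) states lie in the open upper half-plane. -/
def UpperStates (St : StatePred) : Prop :=
  ∀ (η : ℝ) (f : ℂ → ℂ) (x₀ s hmax R Hs : ℝ) (B j : ℕ) (u : ℂ), St η f x₀ s hmax R Hs B j u → 0 < u.im

/-- (K) finite levels ⇒ every inhabited level has a LOWEST state (`HasLowestSig St`; the tree's `hasLowestSig_stCol'` is the `StCol'` instance). -/
theorem hasLowestSig_of_levelFinite {St : StatePred} (hF : LevelFinite St) : HasLowestSig St := by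
  intro η f x₀ s hmax R Hs B hE j u hS
  have hfin := hF η f x₀ s hmax R Hs B hE j
  have hne : {w : ℂ | St η f x₀ s hmax R Hs B j w}.Nonempty := ⟨u, hS⟩
  obtain ⟨v, hv, hmin⟩ := hfin.exists_minimalFor Complex.im _ hne
  refine ⟨v, hv, fun w hw => ?_⟩
  by_contra hlt
  rw [not_le] at hlt
  exact absurd (hmin hw hlt.le) (not_le.mpr hlt)

/-- (K) the interface holds for the node literal `StCol'` (so the generic theorems above specialise to the tree's). -/
theorem levelFinite_stCol' : LevelFinite StCol' := fun _ _ _ _ _ _ _ _ hE j => stColP_level_finite hE j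

/-- W-08 round-2 support (E05a: C4 g23 kit a4c78317 §A–§H): see the module docstring and the source README. -/
theorem upperStates_stCol' : UpperStates StCol' := fun _ _ _ _ _ _ _ _ _ _ h => h.2.2.1

/-- the ONE obligation C1's tracking words owe the K side at level 0: the booked zero is an ambient level-0 state, tracked, of height `≤ hmax`. -/
def TrackedSeed (St₀ T : StatePred) : Prop :=
  ∀ (η : ℝ) (f : ℂ → ℂ) (x₀ s hmax R Hs : ℝ) (B : ℕ), EngineHyps5 2 η f x₀ s hmax R Hs B →
    ∃ u : ℂ, St₀ η f x₀ s hmax R Hs B 0 u ∧ T η f x₀ s hmax R Hs B 0 u ∧ |u.im| ≤ hmax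

/-- the chain predicate of C1's words (the `T` of §E). -/
def LinChain (κ : ℝ) : StatePred := fun η f x₀ s hmax R Hs B j u =>
  ∃ c : ℕ → ℂ, (c 0).re = x₀ ∧ c j = u ∧ (∀ m ≤ j, StCol' η f x₀ s hmax R Hs B m (c m)) ∧
    ∀ m < j, |(c (m + 1)).re - (c m).re| ≤ κ * s

/-- (K) the seed obligation holds for C1's words: the engine's `w₀` (`Re w₀ = x₀`), reflected into the upper half-plane, with the constant chain. -/
theorem trackedSeed_linChain (κ : ℝ) : TrackedSeed StCol' (LinChain κ) := by
  intro η f x₀ s hmax R Hs B hE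
  obtain ⟨hdiff, hreal, -, hs, hsh, -, h3R, hHs, hstrip, -, ⟨w₀, hw0, hwim, hwre, hwh⟩, -⟩ := hE
  have hf : iteratedDeriv 0 f ≠ 0 := by
    intro hf0
    rw [iteratedDeriv_zero] at hf0
    have h := hstrip ((Hs + 1 : ℝ) * I) (by rw [hf0]; rfl)
    have him : (((Hs + 1 : ℝ) : ℂ) * I).im = Hs + 1 := by simp
    rw [him, abs_of_nonneg (by linarith)] at h
    linarith
  have hR : |x₀ - x₀| ≤ R / 2 + ((0 : ℕ) : ℝ) * (s / 4) := by
    rw [sub_self, abs_zero]; push_cast; nlinarith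
  have hwHs : |w₀.im| ≤ Hs := hstrip w₀ hw0
  -- the upper-half-plane representative `u` of the seed, with `Re u = x₀`
  obtain ⟨u, hure, hSt, huh⟩ : ∃ u : ℂ, u.re = x₀ ∧ StCol' η f x₀ s hmax R Hs B 0 u ∧ |u.im| ≤ hmax := by
    rcases lt_or_gt_of_ne hwim with hneg | hpos
    · refine ⟨conj w₀, by rw [Complex.conj_re, hwre], ⟨hf, ?_, ?_, ?_, ?_⟩, ?_⟩
      · rw [iteratedDeriv_zero, Literature.Analysis.Complex.apply_conj_eq_conj hdiff hreal, hw0, map_zero]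
      · rw [Complex.conj_im]; linarith
      · rw [Complex.conj_re, hwre]; exact hR
      · rw [Complex.conj_im]; rw [abs_of_neg hneg] at hwHs; exact hwHs
      · rw [Complex.conj_im, abs_neg]; exact hwh
    · refine ⟨w₀, hwre, ⟨hf, ?_, hpos, ?_, ?_⟩, hwh⟩
      · rw [iteratedDeriv_zero]; exact hw0
      · rw [hwre]; exact hR
      · exact le_trans (le_abs_self _) hwHs
  refine ⟨u, hSt, ⟨fun _ => u, hure, rfl, fun m hm => ?_, fun m hm => absurd hm (Nat.not_lt_zero m)⟩, huh⟩
  rw [Nat.le_zero.mp hm]; exact hSt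

/-- (K) generic: a predicate IMPLYING `StCol'` pointwise inherits `LevelFinite` / `UpperStates` / `NondegStates`. -/
def SubPred (St St₀ : StatePred) : Prop :=
  ∀ (η : ℝ) (f : ℂ → ℂ) (x₀ s hmax R Hs : ℝ) (B j : ℕ) (u : ℂ), St η f x₀ s hmax R Hs B j u → St₀ η f x₀ s hmax R Hs B j u

/-- W-08 round-2 support (E05a: C4 g23 kit a4c78317 §A–§H): see the module docstring and the source README. -/
theorem levelFinite_of_subPred {St St₀ : StatePred} (h : SubPred St St₀) (hF : LevelFinite St₀) : LevelFinite St :=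
  fun η f x₀ s hmax R Hs B hE j => (hF η f x₀ s hmax R Hs B hE j).subset fun u hu => h η f x₀ s hmax R Hs B j u hu

/-- W-08 round-2 support (E05a: C4 g23 kit a4c78317 §A–§H): see the module docstring and the source README. -/
theorem upperStates_of_subPred {St St₀ : StatePred} (h : SubPred St St₀) (hU : UpperStates St₀) : UpperStates St :=
  fun η f x₀ s hmax R Hs B j u hu => hU η f x₀ s hmax R Hs B j u (h η f x₀ s hmax R Hs B j u hu)

end RhW08.StSwap

-- ----- from C4 g24 §K.1–§K.3 5d82679f -----
-- ===== BEGIN C4 g24 sectionK-W08-C4-rh-idea-6-g24.part =====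

namespace RhW08.StSwap

open Complex Set
open RhIdea6.G17.W07C7 RhIdea6.G17.W07C7.Rev6 RhIdea6.G18.W07C8.Law421BirthS RhIdea6.G19.W07C11.Seam
open RhIdea6.G20.W07C12.Frac RhIdea6.G20.W07C12.StColP RhW07.C12.FieldSplit RhIdea6.G20.W07C13pre.Tent RhIdea6.G21.W07C13.TentMax
open RhW07.C14.TwoSided RhW07.C14.Classes RhW07.C14.Lineage

/-- a SUCCESSOR STEP relation `Step η f x₀ s hmax R Hs B m u u'` («`u'` is the chosen level-`(m+1)` successor of the level-`m` state `u`»). -/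
abbrev StepRel : Type := ℝ → (ℂ → ℂ) → ℝ → ℝ → ℝ → ℝ → ℝ → ℕ → ℕ → ℂ → ℂ → Prop

/-- **`ChainOf Step`** — the lineage generated by `Step` from the ROOT COLUMN: level-`j` end points of `Step`-chains starting at a level-0 `StCol'`
state with `Re = x₀`.  (C1's `StTrk` / `StTrkC` / `StTrkD` are `ChainOf TrkStep` / `ChainOf TrkStepC` / `ChainOf TrkStepD`, by `rfl`, §K.2.) -/
def ChainOf (Step : StepRel) : StatePred := fun η f x₀ s hmax R Hs B j u =>
  ∃ c : ℕ → ℂ, StCol' η f x₀ s hmax R Hs B 0 (c 0) ∧ (c 0).re = x₀ ∧ c j = u ∧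
    ∀ m : ℕ, m < j → Step η f x₀ s hmax R Hs B m (c m) (c (m + 1))

/-- the step LANDS in the ambient predicate at the next level. -/
def StepInto (Step : StepRel) (St₀ : StatePred) : Prop :=
  ∀ (η : ℝ) (f : ℂ → ℂ) (x₀ s hmax R Hs : ℝ) (B m : ℕ) (u u' : ℂ), Step η f x₀ s hmax R Hs B m u u' → St₀ η f x₀ s hmax R Hs B (m + 1) u'

/-- (K) chain states are ambient states. -/
theorem subPred_chainOf {Step : StepRel} (h : StepInto Step StCol') : SubPred (ChainOf Step) StCol' := by
  intro η f x₀ s hmax R Hs B j u hu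
  obtain ⟨c, h0, -, hcj, hst⟩ := hu
  cases j with
  | zero => rw [← hcj]; exact h0
  | succ m => rw [← hcj]; exact h η f x₀ s hmax R Hs B m (c m) (c (m + 1)) (hst m (Nat.lt_succ_self m))

/-- W-08 round-2 support (E05a: C4 g24 §K.1–§K.3 5d82679f): see the module docstring and the source README. -/
theorem levelFinite_chainOf {Step : StepRel} (h : StepInto Step StCol') : LevelFinite (ChainOf Step) :=
  levelFinite_of_subPred (subPred_chainOf h) levelFinite_stCol'

/-- W-08 round-2 support (E05a: C4 g24 §K.1–§K.3 5d82679f): see the module docstring and the source README. -/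
theorem upperStates_chainOf {Step : StepRel} (h : StepInto Step StCol') : UpperStates (ChainOf Step) :=
  upperStates_of_subPred (subPred_chainOf h) upperStates_stCol'

/-- (K) level 0 of any chain lineage = the root-column states. -/
theorem chainOf_zero_iff (Step : StepRel) (η : ℝ) (f : ℂ → ℂ) (x₀ s hmax R Hs : ℝ) (B : ℕ) (u : ℂ) :
    ChainOf Step η f x₀ s hmax R Hs B 0 u ↔ StCol' η f x₀ s hmax R Hs B 0 u ∧ u.re = x₀ := by
  constructor
  · rintro ⟨c, h0, hre, hcj, -⟩
    subst hcj
    exact ⟨h0, hre⟩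
  · rintro ⟨hS, hre⟩
    exact ⟨fun _ => u, hS, hre, rfl, fun m hm => absurd hm (Nat.not_lt_zero m)⟩

/-- ★ (K) the SEED for EVERY dial: the engine's `w₀` (`Re w₀ = x₀`), reflected into the upper half-plane, is a level-0 chain state of height `≤ hmax`. -/
theorem init0Sig_chainOf (Step : StepRel) : Init0Sig (ChainOf Step) := by
  intro η f x₀ s hmax R Hs B hE
  obtain ⟨u, hSt, ⟨c, hc0, hcu, -, -⟩, huh⟩ := trackedSeed_linChain 0 η f x₀ s hmax R Hs B hE
  refine ⟨u, (chainOf_zero_iff Step η f x₀ s hmax R Hs B u).mpr ⟨hSt, ?_⟩, huh⟩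
  rw [← hcu]; exact hc0

end RhW08.StSwap
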